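import Summits.Ventures.PercRepro.PendantLemma6

/-!
# The block-flip inequality (C-014) by Harris: the Harris boundary of the 5a block

Five marks `a v q q′ q″` of a multigraph (`G′ = G − g`, `g = a–v`, in the notation of
`proofs/LEAD-C011-concavity.md` §10.5).  Write

* `F = {K_v ∩ {a, q, q′, q″} = {q}}` (`vMark`): the cluster of `v` contains `q` and avoids `a`,
  `q′`, `q″`;
* `N = {the cluster of a contains none of v, q, q′, q″}` (`markFree`);
* `N′ = {a ↮ q′} ∩ {a ↮ q″}` (`avoidPair`, decreasing);
* `J = {q′ ↔ q″}` (increasing).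

Then `B_q = F ∩ N ∩ J`, `A_q = F ∩ N ∩ Jᶜ` and the **block-flip inequality** of
`proofs/P3-lemma6q-injection.md` §8 (recorded as C-014) holds in the stronger form

  `P(F ∩ N ∩ J) · P(Jᶜ) ≤ P(F ∩ N ∩ Jᶜ) · P(J)`   (`vMark_block_flip`),

by a five-line Harris argument: reveal the cluster `C` of `v` (admissible: `q ∈ C`,
`a, q′, q″ ∉ C`); given `C_v = C` the remaining edges are product-distributed on `G − C`, on
which `F ∩ N` reduces to the decreasing event `N′` and `J` is increasing; Harris twice on
`G − C` and the monotonicity `P_{G − C}(J) ≤ P_G(J)` give, per `C`,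
`P_{G−C}(J ∩ N′) · P(Jᶜ) ≤ P_{G−C}(Jᶜ ∩ N′) · P(J)` (`cluster_pivot`); sum over `C`.
The original C-014, `P(B_q) · P(Y) ≤ P(A_q) · P(J)` with `Y = D ∩ Jᶜ ∩ N` the union of the
`Y`-types, is the corollary `C014_block_flip` (`Y ⊆ Jᶜ`).

Significance: C-014 is exactly where Harris stops — the strengthening `J ↦ E^v = D ∩ J ∩ N`
(the general Lemma 6_q) is FALSE (mine-4's exact witness, INBOX 2026-08-22T05:30:24Z, on which
the strong form holds with slack `+3.165·10⁻⁵`).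

The cluster-reveal lemma of `ConditionalNeg.lean` is generalised from events determined by
the cluster of ONE vertex (`ClusterDet`, which also demands monotonicity) to events determined
by the clusters of a SET of vertices (`ClustersDet`, no monotonicity): `J ∩ N′` is determined
by the clusters of `q′` and `a`.
-/

namespace PercRepro

open Finset

namespace MultiGraph

variable {V E : Type*} (G : MultiGraph V E)

/-! ### The events -/

/-- `N′`: the cluster of `a` avoids both `q′` and `q″` (decreasing). -/
def avoidPair (a q' q'' : V) : Set (Config E) := G.sepEvent a q' ∩ G.sepEvent a q''

/-- `N`: the cluster of `a` contains none of `v`, `q`, `q′`, `q″` (the lead's `N`). -/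
def markFree (a v q q' q'' : V) : Set (Config E) :=
  G.sepEvent a v ∩ G.sepEvent a q ∩ G.sepEvent a q' ∩ G.sepEvent a q''

/-- `F`: the cluster of `v` contains `q` and avoids `a`, `q′`, `q″`
(the lead's `F = {K_v ∩ M = {q}}`, `M = {a, q, q′, q″}`). -/
def vMark (v a q q' q'' : V) : Set (Config E) := G.pairEvent v q q' q'' ∩ G.sepEvent v a

/-- `N′` is decreasing. -/
theorem isLowerSet_avoidPair (a q' q'' : V) : IsLowerSet (G.avoidPair a q' q'') :=
  (G.isLowerSet_sepEvent a q').inter (G.isLowerSet_sepEvent a q'')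

/-- Membership in `F` in terms of the cluster of `v`. -/
theorem mem_vMark_iff (v a q q' q'' : V) (ω : Config E) :
    ω ∈ G.vMark v a q q' q'' ↔
      q ∈ G.cluster ω v ∧ a ∉ G.cluster ω v ∧ q' ∉ G.cluster ω v ∧ q'' ∉ G.cluster ω v := by
  rw [vMark, Set.mem_inter_iff, G.mem_pairEvent_iff]
  simp only [sepEvent, connEvent, Set.mem_compl_iff, Set.mem_setOf_eq, cluster]
  tauto

/-- On `F`, the event `N` reduces to `N′`: `a ↮ v` and `a ↮ q` already follow from
`a ∉ K_v ∋ q`. -/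
theorem vMark_inter_markFree (v a q q' q'' : V) :
    G.vMark v a q q' q'' ∩ G.markFree a v q q' q'' =
      G.vMark v a q q' q'' ∩ G.avoidPair a q' q'' := by
  ext ω
  simp only [Set.mem_inter_iff, markFree, avoidPair, G.mem_vMark_iff, sepEvent, connEvent,
    Set.mem_compl_iff, Set.mem_setOf_eq, cluster]
  constructor
  · rintro ⟨hF, ⟨⟨_, _⟩, h3⟩, h4⟩
    exact ⟨hF, h3, h4⟩
  · rintro ⟨⟨hq, ha, hq', hq''⟩, h3, h4⟩
    refine ⟨⟨hq, ha, hq', hq''⟩, ⟨⟨fun hav => ha hav.symm, fun haq => ha (hq.trans haq.symm)⟩,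
      h3⟩, h4⟩

/-! ### Events determined by the clusters of several vertices -/

/-- `G.ClustersDet T B`: the event `B` is determined by the clusters of the vertices of `T`
(no monotonicity is asked, unlike `ClusterDet`). -/
def ClustersDet (T : Set V) (B : Set (Config E)) : Prop :=
  ∀ ⦃ω ω' : Config E⦄, (∀ t ∈ T, G.cluster ω t = G.cluster ω' t) → (ω ∈ B ↔ ω' ∈ B)

/-- `J ∩ N′ = {q′ ↔ q″} ∩ {a ↮ q′} ∩ {a ↮ q″}` is determined by the clusters of `q′` and `a`. -/
theorem clustersDet_connEvent_inter_avoidPair (a q' q'' : V) :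
    G.ClustersDet {q', a} (G.connEvent q' q'' ∩ G.avoidPair a q' q'') := by
  intro ω ω' h
  have h1 : G.cluster ω q' = G.cluster ω' q' := h q' (by simp)
  have h2 : G.cluster ω a = G.cluster ω' a := h a (by simp)
  show (q'' ∈ G.cluster ω q' ∧ q' ∉ G.cluster ω a ∧ q'' ∉ G.cluster ω a) ↔
    (q'' ∈ G.cluster ω' q' ∧ q' ∉ G.cluster ω' a ∧ q'' ∉ G.cluster ω' a)
  rw [h1, h2]

/-- `Jᶜ ∩ N′` is determined by the clusters of `q′` and `a`. -/
theorem clustersDet_sepEvent_inter_avoidPair (a q' q'' : V) :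
    G.ClustersDet {q', a} (G.sepEvent q' q'' ∩ G.avoidPair a q' q'') := by
  intro ω ω' h
  have h1 : G.cluster ω q' = G.cluster ω' q' := h q' (by simp)
  have h2 : G.cluster ω a = G.cluster ω' a := h a (by simp)
  show (q'' ∉ G.cluster ω q' ∧ q' ∉ G.cluster ω a ∧ q'' ∉ G.cluster ω a) ↔
    (q'' ∉ G.cluster ω' q' ∧ q' ∉ G.cluster ω' a ∧ q'' ∉ G.cluster ω' a)
  rw [h1, h2]

section Prob

variable [Fintype E] [DecidableEq E]

variable {G}

open Classical in
/-- **Conditional independence given the cluster of `s`**, for `B` determined by the clusters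
of the vertices of `T`, all outside `W` (`K` = the edges touching `W`):
`P(B ∩ {C_s = W}) = P_{zeroOn p K}(B) · P(C_s = W)`.  (The proof of
`expect_ite_cluster_eq_indicator` with `ClusterDet.mem_iff_of_eq` replaced by `ClustersDet`.) -/
theorem expect_ite_cluster_eq_indicator_of_clustersDet (s : V) (p : E → ℝ) {T : Set V}
    {B : Set (Config E)} (hB : G.ClustersDet T B) {W : Set V} (hT : ∀ t ∈ T, t ∉ W)
    {K : Finset E} (hK : ∀ e, e ∈ K ↔ (G.fst e ∈ W ∨ G.snd e ∈ W)) :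
    expect p (fun ω => if G.cluster ω s = W then B.indicator 1 ω else 0) =
      prob (zeroOn p K) B * expect p (fun ω => if G.cluster ω s = W then 1 else 0) := by
  rw [expect_eq_sum_keepOn p K,
    expect_eq_sum_keepOn p K (fun ω => if G.cluster ω s = W then 1 else 0), Finset.mul_sum]
  refine Finset.sum_congr rfl fun ζ _ => ?_
  by_cases hw : weight (keepOn p K) ζ = 0
  · rw [hw]
    ring
  · have hζ := closedOff_of_weight_keepOn_ne_zero hw
    have e1 : expect (zeroOn p K)
        (fun ω => if G.cluster (ζ ⊔ ω) s = W then B.indicator 1 (ζ ⊔ ω) else 0) =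
          (if G.cluster ζ s = W then 1 else 0) * expect (zeroOn p K) (B.indicator 1) := by
      by_cases hW : G.cluster ζ s = W
      · rw [if_pos hW, one_mul]
        apply expect_congr_of_support
        intro ω hω
        have hωK := closedOn_of_weight_zeroOn_ne_zero hω
        have hc : G.cluster (ζ ⊔ ω) s = W := (cluster_sup_eq_iff s hK hωK).2 hW
        rw [if_pos hc]
        have hiff : ζ ⊔ ω ∈ B ↔ ω ∈ B :=
          hB fun t ht => cluster_sup_eq_of_cluster_eq s t hK hζ hc (hT t ht)
        by_cases hb : ω ∈ B
        · rw [Set.indicator_of_mem hb, Set.indicator_of_mem (hiff.2 hb)]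
          rfl
        · rw [Set.indicator_of_notMem hb, Set.indicator_of_notMem (fun h => hb (hiff.1 h))]
      · rw [if_neg hW, zero_mul]
        calc expect (zeroOn p K)
              (fun ω => if G.cluster (ζ ⊔ ω) s = W then B.indicator 1 (ζ ⊔ ω) else 0)
            = expect (zeroOn p K) (fun _ => (0 : ℝ)) := by
              apply expect_congr_of_support
              intro ω hω
              have hωK := closedOn_of_weight_zeroOn_ne_zero hω
              rw [if_neg (fun hc => hW ((cluster_sup_eq_iff s hK hωK).1 hc))]
          _ = 0 := expect_const _ 0
    have e2 : expect (zeroOn p K) (fun ω => if G.cluster (ζ ⊔ ω) s = W then (1 : ℝ) else 0) =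
        (if G.cluster ζ s = W then 1 else 0) := by
      by_cases hW : G.cluster ζ s = W
      · rw [if_pos hW]
        calc expect (zeroOn p K) (fun ω => if G.cluster (ζ ⊔ ω) s = W then (1 : ℝ) else 0)
            = expect (zeroOn p K) (fun _ => (1 : ℝ)) := by
              apply expect_congr_of_support
              intro ω hω
              have hωK := closedOn_of_weight_zeroOn_ne_zero hω
              rw [if_pos ((cluster_sup_eq_iff s hK hωK).2 hW)]
          _ = 1 := expect_const _ 1
      · rw [if_neg hW]
        calc expect (zeroOn p K) (fun ω => if G.cluster (ζ ⊔ ω) s = W then (1 : ℝ) else 0)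
            = expect (zeroOn p K) (fun _ => (0 : ℝ)) := by
              apply expect_congr_of_support
              intro ω hω
              have hωK := closedOn_of_weight_zeroOn_ne_zero hω
              rw [if_neg (fun hc => hW ((cluster_sup_eq_iff s hK hωK).1 hc))]
          _ = 0 := expect_const _ 0
    rw [e1, e2, prob_eq_expect_indicator]
    ring

open Classical in
/-- **Integrating out `B` given the cluster of `s`**, for `B` determined by the clusters of the
vertices of `T` and a function `Ψ` of the cluster of `s` vanishing whenever the cluster meets
`T`: `E[Ψ(C_s) · 1_B] = E[Ψ(C_s) · H]` with `H(ω) = P_{zeroOn p (edges at C_s(ω))}(B)`. -/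
theorem expect_clusterFun_mul_indicator_of_clustersDet (s : V) (p : E → ℝ) {T : Set V}
    {B : Set (Config E)} (hB : G.ClustersDet T B) (Ψ : Set V → ℝ)
    (hΨ : ∀ W, (∃ t ∈ T, t ∈ W) → Ψ W = 0) :
    expect p (fun ω => Ψ (G.cluster ω s) * B.indicator 1 ω) =
      expect p (fun ω => Ψ (G.cluster ω s) *
        prob (zeroOn p (G.touchingFinset (G.cluster ω s))) B) := by
  rw [expect_eq_sum_cluster s p, expect_eq_sum_cluster s p
    (fun ω => Ψ (G.cluster ω s) * prob (zeroOn p (G.touchingFinset (G.cluster ω s))) B)]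
  refine Finset.sum_congr rfl fun W _ => ?_
  have e1 : (fun ω => if G.cluster ω s = W then Ψ (G.cluster ω s) * B.indicator 1 ω else 0) =
      fun ω => Ψ W * (if G.cluster ω s = W then B.indicator 1 ω else 0) := by
    funext ω
    split_ifs with hc
    · rw [hc]
    · ring
  have e2 : (fun ω => if G.cluster ω s = W then
        Ψ (G.cluster ω s) * prob (zeroOn p (G.touchingFinset (G.cluster ω s))) B else 0) =
      fun ω => (Ψ W * prob (zeroOn p (G.touchingFinset W)) B) *
        (if G.cluster ω s = W then 1 else 0) := by
    funext ω
    split_ifs with hc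
    · rw [hc]
      ring
    · ring
  rw [e1, e2, expect_const_mul, expect_const_mul]
  by_cases ht : ∃ t ∈ T, t ∈ W
  · rw [hΨ W ht, zero_mul, zero_mul, zero_mul]
  · have ht' : ∀ t ∈ T, t ∉ W := fun t ht1 htW => ht ⟨t, ht1, htW⟩
    rw [expect_ite_cluster_eq_indicator_of_clustersDet s p hB ht' (fun e => G.mem_touchingFinset)]
    ring

/-! ### The per-cluster pivot and the theorem -/

variable (G)

/-- **The per-cluster pivot**: on the revealed-cluster measure `p′ ≤ p` (the edges at `C_v`
switched off), with `J = {q′ ↔ q″}` increasing and `N′` decreasing,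
`P_{p′}(J ∩ N′) · P_p(Jᶜ) ≤ P_{p′}(Jᶜ ∩ N′) · P_p(J)` — Harris twice and
`P_{p′}(J) ≤ P_p(J)`. -/
theorem cluster_pivot (a q' q'' : V) {p p' : E → ℝ} (hp : IsProb p) (hp' : IsProb p')
    (hle : p' ≤ p) :
    prob p' (G.connEvent q' q'' ∩ G.avoidPair a q' q'') * prob p (G.sepEvent q' q'') ≤
      prob p' (G.sepEvent q' q'' ∩ G.avoidPair a q' q'') * prob p (G.connEvent q' q'') := by
  have h1 := harris_upper_lower hp' (G.isUpperSet_connEvent q' q'') (G.isLowerSet_avoidPair a q' q'')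
  have h2 := harris_lower hp' (G.isLowerSet_sepEvent q' q'') (G.isLowerSet_avoidPair a q' q'')
  have h3 := prob_mono_of_isUpperSet hp' hp hle (G.isUpperSet_connEvent q' q'')
  have hc : prob p (G.sepEvent q' q'') = 1 - prob p (G.connEvent q' q'') := prob_compl p _
  have hc' : prob p' (G.sepEvent q' q'') = 1 - prob p' (G.connEvent q' q'') := prob_compl p' _
  have hn0 := prob_nonneg hp' (G.avoidPair a q' q'')
  have hy0 := prob_nonneg hp (G.connEvent q' q'')
  have hy1 := prob_le_one hp (G.connEvent q' q'')
  have hx0 := prob_nonneg hp' (G.connEvent q' q'')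
  rw [hc] at *
  rw [hc'] at h2
  nlinarith [mul_le_mul_of_nonneg_right h1 (sub_nonneg.2 hy1),
    mul_le_mul_of_nonneg_right h2 hy0, mul_le_mul_of_nonneg_left h3 hn0]

open Classical in
/-- **The block-flip inequality (C-014), strong form**:
`P(F ∩ N ∩ J) · P(Jᶜ) ≤ P(F ∩ N ∩ Jᶜ) · P(J)`, i.e. `P(B_q) · P(Jᶜ) ≤ P(A_q) · P(J)`
for every multigraph, every `p` and every five marks `a v q q′ q″`.
Proof: reveal the cluster of `v`, integrate out `J ∩ N′` resp. `Jᶜ ∩ N′` on `G − C_v`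
(`expect_clusterFun_mul_indicator_of_clustersDet`), and apply `cluster_pivot` pointwise. -/
theorem vMark_block_flip (a v q q' q'' : V) {p : E → ℝ} (hp : IsProb p) :
    prob p (G.vMark v a q q' q'' ∩ G.markFree a v q q' q'' ∩ G.connEvent q' q'') *
        prob p (G.sepEvent q' q'') ≤
      prob p (G.vMark v a q q' q'' ∩ G.markFree a v q q' q'' ∩ G.sepEvent q' q'') *
        prob p (G.connEvent q' q'') := by
  rw [G.vMark_inter_markFree]
  -- the indicator of `F` as a function of the cluster of `v`
  set Ψ : Set V → ℝ := fun W => if q ∈ W ∧ a ∉ W ∧ q' ∉ W ∧ q'' ∉ W then 1 else 0 with hΨdef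
  have hΨ0 : ∀ W, 0 ≤ Ψ W := fun W => by
    simp only [hΨdef]
    split_ifs <;> norm_num
  have hΨT : ∀ W, (∃ t ∈ ({q', a} : Set V), t ∈ W) → Ψ W = 0 := by
    rintro W ⟨t, ht, htW⟩
    simp only [Set.mem_insert_iff, Set.mem_singleton_iff] at ht
    rcases ht with rfl | rfl
    · simp [hΨdef, htW]
    · simp [hΨdef, htW]
  have hF : (G.vMark v a q q' q'').indicator (1 : Config E → ℝ) =
      fun ω => Ψ (G.cluster ω v) := by
    funext ω
    by_cases hω : ω ∈ G.vMark v a q q' q''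
    · rw [Set.indicator_of_mem hω]
      have h := (G.mem_vMark_iff v a q q' q'' ω).1 hω
      show (1 : ℝ) = if q ∈ G.cluster ω v ∧ a ∉ G.cluster ω v ∧ q' ∉ G.cluster ω v ∧
        q'' ∉ G.cluster ω v then 1 else 0
      rw [if_pos h]
    · rw [Set.indicator_of_notMem hω]
      have h : ¬ (q ∈ G.cluster ω v ∧ a ∉ G.cluster ω v ∧ q' ∉ G.cluster ω v ∧
          q'' ∉ G.cluster ω v) := fun h => hω ((G.mem_vMark_iff v a q q' q'' ω).2 h)
      show (0 : ℝ) = if q ∈ G.cluster ω v ∧ a ∉ G.cluster ω v ∧ q' ∉ G.cluster ω v ∧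
        q'' ∉ G.cluster ω v then 1 else 0
      rw [if_neg h]
  -- the two probabilities as expectations of `Ψ(C_v) · 1_B`
  have e1 : prob p (G.vMark v a q q' q'' ∩ G.avoidPair a q' q'' ∩ G.connEvent q' q'') =
      expect p (fun ω => Ψ (G.cluster ω v) *
        (G.connEvent q' q'' ∩ G.avoidPair a q' q'').indicator 1 ω) := by
    rw [Set.inter_assoc, Set.inter_comm (G.avoidPair a q' q''), prob_eq_expect_indicator,
      Set.inter_indicator_one, hF]
    rfl
  have e2 : prob p (G.vMark v a q q' q'' ∩ G.avoidPair a q' q'' ∩ G.sepEvent q' q'') =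
      expect p (fun ω => Ψ (G.cluster ω v) *
        (G.sepEvent q' q'' ∩ G.avoidPair a q' q'').indicator 1 ω) := by
    rw [Set.inter_assoc, Set.inter_comm (G.avoidPair a q' q''), prob_eq_expect_indicator,
      Set.inter_indicator_one, hF]
    rfl
  rw [e1, e2,
    expect_clusterFun_mul_indicator_of_clustersDet v p
      (G.clustersDet_connEvent_inter_avoidPair a q' q'') Ψ hΨT,
    expect_clusterFun_mul_indicator_of_clustersDet v p
      (G.clustersDet_sepEvent_inter_avoidPair a q' q'') Ψ hΨT,
    mul_comm _ (prob p (G.sepEvent q' q'')), mul_comm _ (prob p (G.connEvent q' q'')),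
    ← expect_const_mul, ← expect_const_mul]
  refine expect_mono hp fun ω => ?_
  have hpiv := G.cluster_pivot a q' q'' hp (isProb_zeroOn hp (G.touchingFinset (G.cluster ω v)))
    (zeroOn_le hp (G.touchingFinset (G.cluster ω v)))
  have := mul_le_mul_of_nonneg_left hpiv (hΨ0 (G.cluster ω v))
  nlinarith [this]

/-- **C-014** (`proofs/P3-lemma6q-injection.md` §8, `LEAD-C011-concavity.md` §10.8):
`P(B_q) · P(Y) ≤ P(A_q) · P(J)`, where `B_q = F ∩ N ∩ J`, `A_q = F ∩ N ∩ Jᶜ` and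
`Y = D ∩ Jᶜ ∩ N` is the union of the `Y`-types (`D` = `attachEvent v q q′ q″`: each of `v`, `q`
is joined to `q′` or `q″`).  Immediate from `vMark_block_flip` since `Y ⊆ Jᶜ`. -/
theorem C014_block_flip (a v q q' q'' : V) {p : E → ℝ} (hp : IsProb p) :
    prob p (G.vMark v a q q' q'' ∩ G.markFree a v q q' q'' ∩ G.connEvent q' q'') *
        prob p (G.attachEvent v q q' q'' ∩ G.sepEvent q' q'' ∩ G.markFree a v q q' q'') ≤
      prob p (G.vMark v a q q' q'' ∩ G.markFree a v q q' q'' ∩ G.sepEvent q' q'') *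
        prob p (G.connEvent q' q'') := by
  have hY : prob p (G.attachEvent v q q' q'' ∩ G.sepEvent q' q'' ∩ G.markFree a v q q' q'') ≤
      prob p (G.sepEvent q' q'') :=
    prob_mono hp fun ω hω => hω.1.2
  have h0 := prob_nonneg hp
    (G.vMark v a q q' q'' ∩ G.markFree a v q q' q'' ∩ G.connEvent q' q'')
  exact le_trans (mul_le_mul_of_nonneg_left hY h0) (G.vMark_block_flip a v q q' q'' hp)

end Prob

end MultiGraph

end PercRepro
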